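import Mathlib
import Summits.PneNP.PneNP.Theorems.CnfIdealGenLengthRankDefectRepresentationsSharpAntipodal
import Summits.PneNP.PneNP.Theorems.CnfIdealGenLengthRankDefectRepresentationsDoubleMaxCutTwoClasses
import Summits.HodgeConjecture.HodgeConjecture.Theorems.HodgeLocusCensusRankReduction

/-!
# Crux `RankDefectRepresentations` (stmt-PneNP-18923), line `rank-dehn-ladder`: COLUMN SATURATION OF ONE HALF MAKES THE OTHER HALF CHEAP
# (registered tool stub `stub_columnSaturation`, lead g15 RESHAPE 11; memo `Cruxes/RankDefectRepresentations/Lines/rank-dehn-ladder-g15.md` §8, §8b)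

Two-family instances (`…TwoFamilyCutDomination`, `…QuadrantCapture`): rows/columns carry first-family colours `colourI` and second-family colours `colourJ`
(`n' + 1` second-family coordinates); the two HALVES are the rows/columns whose last second-family bit is `false` (half 0) resp. `true` (half 1); `c₀`
bounds the rank of every first rectangle `rect row col B B' true true D`.

THEOREM (`stub_columnSaturation`).  Suppose that for every first-family class `p` occurring among the columns of half 1, half 0 is SATURATED at the
co-singleton column cut `p`: some rectangle of half 0 with rows of classes `≠ p` (second-family colours in a set `S'`) and columns of class `p` (colours
outside `S'`) has rank `≥ c₀`.  Then ONE matrix of rank `≤ 8c₀` agrees with `D` on every visible cell of half 1.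
PROOF ("shadows through the cross").  (1) The cross block `Y` (half-1 rows × half-0 columns) is a one-family instance for the first-family colouring whose
bipartition cuts are first rectangles of `D` at `B' = {last bit = true}`, so Theorem 2 (`exists_blockDiagonal_of_cuts_le`) gives `L = Y − R'` of rank `≤ 8c₀`
agreeing with `D` on the cross cells whose first-family colours differ.  (2) For a half-1 column `y` of class `p`, an invertible maximal minor
`A = D[X₀,Y₀]` of the saturated rectangle (`exists_submatrix_det_ne_zero`) and a half-1 row `x` with `colourI ≠ p`, `colourJ ≠ colourJ y` give a bordered
matrix `[[A, D[X₀,y]],[D[x,Y₀], D[x,y]]]` which is a submatrix of the first rectangle at `(classes ≠ p, (S' ∩ half 0) ∪ {colourJ x})`, hence of rank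
`≤ c₀ ≤ rank A`; the Schur identity (`rank_fromBlocks_of_invertible₁₁`, p708234) forces `D[x,y] = D[x,Y₀] A⁻¹ D[X₀,y]`, and `D[x,Y₀] = L[x,Y₀]` on these
cells.  (3) So column `y` of half 1 is `L` times a coefficient vector: the completion `Z := L · C` has rank `≤ rank L ≤ 8c₀`.
This is the first kernel instance of "shadow ⟹ sharing" on the line (the saturated extreme of the MERGE problem).  HONEST FRAMING: elementary linear
algebra in the tool lane of the crux; P ≠ NP is not moved; F-N2 is a FRONTIER formal rung.
-/

set_option linter.dupNamespace false -- `Summit.PneNP.PneNP.…`: summit = sub-problem name (D-0017)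

namespace Summit.PneNP.PneNP.Theorems.CnfIdealGenLengthRankDefectRepresentationsColumnSaturation

open Matrix
open Summit.PneNP.PneNP.Theorems.CnfIdealGenLengthRankDefectRepresentationsTwoFamilyCutDomination (colourI colourJ)
open Summit.PneNP.PneNP.Theorems.CnfIdealGenLengthRankDefectRepresentationsQuadrantCapture (rect rect_apply)
open Summit.PneNP.PneNP.Theorems.CnfIdealGenLengthRankDefectRepresentationsDoubleMaxCutTwoClasses (exists_blockDiagonal_of_cuts_le)
open Summit.PneNP.PneNP.Theorems.CnfIdealGenLengthRankDefectRepresentationsSharpAntipodal (rank_fromBlocks_of_invertible₁₁)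
open Summit.HodgeConjecture.HodgeConjecture.HodgeLocus.Census.RankReduction (exists_submatrix_det_ne_zero)

variable {K : Type} [Field K]

/-- A `Unit × Unit` matrix of rank `0` is zero. [folklore] -/
theorem entry_eq_zero_of_rank_eq_zero (S : Matrix Unit Unit K) (h : S.rank = 0) : S () () = 0 := by
  by_contra hne
  have hU : IsUnit S := by
    rw [Matrix.isUnit_iff_isUnit_det, Matrix.det_unique]
    exact isUnit_iff_ne_zero.mpr hne
  have := Matrix.rank_of_isUnit S hU
  simp [h] at this

/-- **COLUMN SATURATION ⟹ CHEAP** (registered stub `stub_columnSaturation` of `Cruxes/RankDefectRepresentations/Lines/rank_dehn_ladder.lean`, lead g15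
RESHAPE 11).  See the module docstring. -/
theorem stub_columnSaturation :
    ∀ (K : Type) [Field K] (n n' : ℕ) (ι ι' : Type) [Fintype ι] [Fintype ι'] [DecidableEq ι] [DecidableEq ι']
      (row : ι → Fin n ⊕ Fin (n' + 1) → Bool) (col : ι' → Fin n ⊕ Fin (n' + 1) → Bool) (D : Matrix ι ι' K) (c₀ : ℕ),
      (∀ B B', (Summit.PneNP.PneNP.Theorems.CnfIdealGenLengthRankDefectRepresentationsQuadrantCapture.rect row col B B' true true D).rank ≤ c₀) →
      (∀ p : Fin n → Bool,
        (∃ y, Summit.PneNP.PneNP.Theorems.CnfIdealGenLengthRankDefectRepresentationsTwoFamilyCutDomination.colourI (col y) = p ∧ col y (Sum.inr (Fin.last n')) = true) →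
        ∃ S' : Finset (Fin (n' + 1) → Bool),
          c₀ ≤ (Matrix.of fun x y =>
            if Summit.PneNP.PneNP.Theorems.CnfIdealGenLengthRankDefectRepresentationsTwoFamilyCutDomination.colourI (row x) ≠ p ∧ row x (Sum.inr (Fin.last n')) = false ∧
                Summit.PneNP.PneNP.Theorems.CnfIdealGenLengthRankDefectRepresentationsTwoFamilyCutDomination.colourJ (row x) ∈ S' ∧
                Summit.PneNP.PneNP.Theorems.CnfIdealGenLengthRankDefectRepresentationsTwoFamilyCutDomination.colourI (col y) = p ∧ col y (Sum.inr (Fin.last n')) = false ∧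
                Summit.PneNP.PneNP.Theorems.CnfIdealGenLengthRankDefectRepresentationsTwoFamilyCutDomination.colourJ (col y) ∉ S'
            then D x y else 0).rank) →
      ∃ Z : Matrix ι ι' K, Z.rank ≤ 8 * c₀ ∧
        ∀ x y, row x (Sum.inr (Fin.last n')) = true → col y (Sum.inr (Fin.last n')) = true →
          Summit.PneNP.PneNP.Theorems.CnfIdealGenLengthRankDefectRepresentationsTwoFamilyCutDomination.colourI (row x) ≠
            Summit.PneNP.PneNP.Theorems.CnfIdealGenLengthRankDefectRepresentationsTwoFamilyCutDomination.colourI (col y) →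
          Summit.PneNP.PneNP.Theorems.CnfIdealGenLengthRankDefectRepresentationsTwoFamilyCutDomination.colourJ (row x) ≠
            Summit.PneNP.PneNP.Theorems.CnfIdealGenLengthRankDefectRepresentationsTwoFamilyCutDomination.colourJ (col y) →
          Z x y = D x y := by
  intro K _ n n' ι ι' _ _ _ _ row col D c₀ hrect hsat
  classical
  -- the set of second-family colours of half 1
  set H₁ : Finset (Fin (n' + 1) → Bool) := Finset.univ.filter fun σ => σ (Fin.last n') = true with hH₁
  have memH₁ : ∀ σ : Fin (n' + 1) → Bool, σ ∈ H₁ ↔ σ (Fin.last n') = true := by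
    intro σ; simp [hH₁]
  have cJrow : ∀ x, colourJ (row x) (Fin.last n') = row x (Sum.inr (Fin.last n')) := fun x => rfl
  have cJcol : ∀ y, colourJ (col y) (Fin.last n') = col y (Sum.inr (Fin.last n')) := fun y => rfl
  -- (1) the cross block and its one-family completion
  set Y : Matrix ι ι' K := Matrix.of fun x j =>
    if row x (Sum.inr (Fin.last n')) = true ∧ col j (Sum.inr (Fin.last n')) = false then D x j else 0 with hY
  have hYcuts : ∀ S : Finset (Fin n → Bool),
      (Matrix.of fun x y => if colourI (row x) ∈ S ∧ colourI (col y) ∉ S then Y x y else 0).rank +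
        (Matrix.of fun x y => if colourI (row x) ∉ S ∧ colourI (col y) ∈ S then Y x y else 0).rank ≤ 2 * c₀ := by
    intro S
    have e1 : (Matrix.of fun x y => if colourI (row x) ∈ S ∧ colourI (col y) ∉ S then Y x y else 0) = rect row col S H₁ true true D := by
      ext x y
      simp only [Matrix.of_apply, rect_apply, hY, Bool.not_true, decide_eq_true_eq, decide_eq_false_iff_not, memH₁, cJrow, cJcol]
      by_cases h1 : colourI (row x) ∈ S <;> by_cases h2 : colourI (col y) ∈ S <;>
        rcases Bool.eq_false_or_eq_true (row x (Sum.inr (Fin.last n'))) with h3 | h3 <;>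
        rcases Bool.eq_false_or_eq_true (col y (Sum.inr (Fin.last n'))) with h4 | h4 <;> simp [h1, h2, h3, h4]
    have e2 : (Matrix.of fun x y => if colourI (row x) ∉ S ∧ colourI (col y) ∈ S then Y x y else 0) = rect row col Sᶜ H₁ true true D := by
      ext x y
      simp only [Matrix.of_apply, rect_apply, hY, Bool.not_true, decide_eq_true_eq, decide_eq_false_iff_not, memH₁, cJrow, cJcol,
        Finset.mem_compl]
      by_cases h1 : colourI (row x) ∈ S <;> by_cases h2 : colourI (col y) ∈ S <;>
        rcases Bool.eq_false_or_eq_true (row x (Sum.inr (Fin.last n'))) with h3 | h3 <;>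
        rcases Bool.eq_false_or_eq_true (col y (Sum.inr (Fin.last n'))) with h4 | h4 <;> simp [h1, h2, h3, h4]
    rw [e1, e2]
    have := hrect S H₁; have := hrect Sᶜ H₁; omega
  obtain ⟨R', hR', hLr⟩ := exists_blockDiagonal_of_cuts_le (fun x => colourI (row x)) (fun y => colourI (col y)) Y (2 * c₀) hYcuts
  set L : Matrix ι ι' K := Y - R' with hLdef
  have hLD : ∀ x j, row x (Sum.inr (Fin.last n')) = true → col j (Sum.inr (Fin.last n')) = false → colourI (row x) ≠ colourI (col j) →
      L x j = D x j := by
    intro x j hx hj hne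
    rw [hLdef, Matrix.sub_apply, hR' x j hne, sub_zero, hY, Matrix.of_apply, if_pos ⟨hx, hj⟩]
  -- (2) every column of half 1 is a shadow: `L *ᵥ v = D[·, y]` on the relevant rows
  have key : ∀ y : ι', col y (Sum.inr (Fin.last n')) = true → ∃ v : ι' → K,
      ∀ x, row x (Sum.inr (Fin.last n')) = true → colourI (row x) ≠ colourI (col y) → colourJ (row x) ≠ colourJ (col y) →
        (L *ᵥ v) x = D x y := by
    intro y hy
    set p := colourI (col y) with hp
    obtain ⟨S', hS'⟩ := hsat p ⟨y, rfl, hy⟩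
    set M : Matrix ι ι' K := Matrix.of fun x y =>
        if colourI (row x) ≠ p ∧ row x (Sum.inr (Fin.last n')) = false ∧ colourJ (row x) ∈ S' ∧
            colourI (col y) = p ∧ col y (Sum.inr (Fin.last n')) = false ∧ colourJ (col y) ∉ S'
        then D x y else 0 with hM
    obtain ⟨rows, cols, hdet⟩ := exists_submatrix_det_ne_zero M
    set A : Matrix (Fin M.rank) (Fin M.rank) K := M.submatrix rows cols with hAdef
    have hrows : ∀ i, colourI (row (rows i)) ≠ p ∧ row (rows i) (Sum.inr (Fin.last n')) = false ∧ colourJ (row (rows i)) ∈ S' := by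
      intro i
      by_contra h
      apply hdet
      refine Matrix.det_eq_zero_of_row_eq_zero i fun j => ?_
      simp only [hAdef, Matrix.submatrix_apply, hM, Matrix.of_apply]
      rw [if_neg]
      tauto
    have hcols : ∀ j, colourI (col (cols j)) = p ∧ col (cols j) (Sum.inr (Fin.last n')) = false ∧ colourJ (col (cols j)) ∉ S' := by
      intro j
      by_contra h
      apply hdet
      refine Matrix.det_eq_zero_of_column_eq_zero j fun i => ?_
      simp only [hAdef, Matrix.submatrix_apply, hM, Matrix.of_apply]
      rw [if_neg]
      tauto
    have hA : ∀ i j, A i j = D (rows i) (cols j) := by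
      intro i j
      simp only [hAdef, Matrix.submatrix_apply, hM, Matrix.of_apply]
      rw [if_pos ⟨(hrows i).1, (hrows i).2.1, (hrows i).2.2, (hcols j).1, (hcols j).2.1, (hcols j).2.2⟩]
    haveI : Invertible A := A.invertibleOfIsUnitDet (isUnit_iff_ne_zero.mpr hdet)
    have hArank : A.rank = M.rank := by
      rw [Matrix.rank_of_isUnit A ((Matrix.isUnit_iff_isUnit_det A).mpr (isUnit_iff_ne_zero.mpr hdet)), Fintype.card_fin]
    -- coefficients of the shadow of column `y`
    set β : Fin M.rank → K := (⅟A) *ᵥ (fun i => D (rows i) y) with hβ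
    refine ⟨fun j' => ∑ j : Fin M.rank, if cols j = j' then β j else 0, ?_⟩
    intro x hx hxI hxJ
    -- the value of `L *ᵥ v` at `x`
    have hLv : (L *ᵥ fun j' => ∑ j : Fin M.rank, if cols j = j' then β j else 0) x = ∑ j : Fin M.rank, D x (cols j) * β j := by
      simp only [Matrix.mulVec, dotProduct, Finset.mul_sum]
      rw [Finset.sum_comm]
      refine Finset.sum_congr rfl fun j _ => ?_
      simp only [mul_ite, mul_zero]
      rw [Finset.sum_ite_eq]
      simp only [Finset.mem_univ, if_true]
      rw [hLD x (cols j) hx (hcols j).2.1 (by rw [(hcols j).1]; exact hxI)]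
    rw [hLv]
    -- the bordered matrix is a submatrix of a first rectangle, hence has rank `≤ c₀ ≤ rank A`
    set E : Matrix (Fin M.rank) Unit K := fun i _ => D (rows i) y with hE
    set F : Matrix Unit (Fin M.rank) K := fun _ j => D x (cols j) with hF
    set G : Matrix Unit Unit K := fun _ _ => D x y with hG
    set N : Matrix (Fin M.rank ⊕ Unit) (Fin M.rank ⊕ Unit) K := Matrix.fromBlocks A E F G with hN
    set B : Finset (Fin n → Bool) := Finset.univ.filter fun σ => σ ≠ p with hB
    set B'' : Finset (Fin (n' + 1) → Bool) := (S'.filter fun σ => σ (Fin.last n') = false) ∪ {colourJ (row x)} with hB''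
    set T : Matrix ι ι' K := rect row col B B'' true true D with hT
    have hTD : ∀ (u : Fin M.rank ⊕ Unit) (w : Fin M.rank ⊕ Unit),
        T (Sum.elim rows (fun _ => x) u) (Sum.elim cols (fun _ => y) w) = D (Sum.elim rows (fun _ => x) u) (Sum.elim cols (fun _ => y) w) := by
      intro u w
      have memB : ∀ σ : Fin n → Bool, σ ∈ B ↔ σ ≠ p := by
        intro σ; simp [hB]
      have memB'' : ∀ σ : Fin (n' + 1) → Bool, σ ∈ B'' ↔ σ = colourJ (row x) ∨ (σ ∈ S' ∧ σ (Fin.last n') = false) := by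
        intro σ; simp [hB'']
      have hr : colourI (row (Sum.elim rows (fun _ => x) u)) ∈ B ∧ colourJ (row (Sum.elim rows (fun _ => x) u)) ∈ B'' := by
        rcases u with i | u
        · rw [Sum.elim_inl, memB, memB'']
          exact ⟨(hrows i).1, Or.inr ⟨(hrows i).2.2, by rw [cJrow]; exact (hrows i).2.1⟩⟩
        · rw [Sum.elim_inr, memB, memB'']
          exact ⟨hxI, Or.inl rfl⟩
      have hc : colourI (col (Sum.elim cols (fun _ => y) w)) ∉ B ∧ colourJ (col (Sum.elim cols (fun _ => y) w)) ∉ B'' := by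
        rcases w with j | w
        · rw [Sum.elim_inl, memB, memB'', not_not, not_or]
          refine ⟨(hcols j).1, fun h => ?_, fun h => (hcols j).2.2 h.1⟩
          have h1 := congrFun h (Fin.last n')
          rw [cJcol, cJrow, (hcols j).2.1, hx] at h1
          exact Bool.false_ne_true h1
        · rw [Sum.elim_inr, memB, memB'', not_not, not_or]
          refine ⟨hp.symm, fun h => hxJ h.symm, fun h => ?_⟩
          have h1 := h.2
          rw [cJcol, hy] at h1
          exact Bool.noConfusion h1
      have hcond : (decide (colourI (row (Sum.elim rows (fun _ => x) u)) ∈ B) = true ∧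
            decide (colourJ (row (Sum.elim rows (fun _ => x) u)) ∈ B'') = true) ∧
          (decide (colourI (col (Sum.elim cols (fun _ => y) w)) ∈ B) = !true ∧
            decide (colourJ (col (Sum.elim cols (fun _ => y) w)) ∈ B'') = !true) := by
        simp only [Bool.not_true, decide_eq_true_eq, decide_eq_false_iff_not]
        exact ⟨hr, hc⟩
      rw [hT, rect_apply, if_pos hcond]
    have hNT : N = T.submatrix (Sum.elim rows (fun _ => x)) (Sum.elim cols (fun _ => y)) := by
      ext u w
      rw [Matrix.submatrix_apply, hTD]
      rcases u with i | u <;> rcases w with j | w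
      · simp [hN, hA]
      · simp [hN, hE]
      · simp [hN, hF]
      · simp [hN, hG]
    have hNc : N.rank ≤ c₀ := by
      rw [hNT]; exact (Matrix.rank_submatrix_le _ _ _).trans (hrect _ _)
    have hSchur := rank_fromBlocks_of_invertible₁₁ A E F G
    have hS0 : (G - F * ⅟A * E).rank = 0 := by
      have h1 : A.rank + (G - F * ⅟A * E).rank ≤ c₀ := by rw [← hSchur, ← hN]; exact hNc
      rw [hArank] at h1
      omega
    have hentry := entry_eq_zero_of_rank_eq_zero _ hS0
    -- read off the identity `D x y = Σ_j D x (cols j) * β j`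
    have hFAE : (F * ⅟A * E) () () = ∑ j : Fin M.rank, D x (cols j) * β j := by
      rw [Matrix.mul_assoc, Matrix.mul_apply]
      refine Finset.sum_congr rfl fun j _ => ?_
      rw [Matrix.mul_apply, hβ]
      rfl
    rw [Matrix.sub_apply, hFAE] at hentry
    have : G () () = D x y := rfl
    rw [this] at hentry
    exact (sub_eq_zero.mp hentry).symm
  -- (3) assemble the completion column by column inside `colspace L`
  choose v hv using key
  let C : Matrix ι' ι' K := Matrix.of fun j' y => if h : col y (Sum.inr (Fin.last n')) = true then v y h j' else 0
  refine ⟨L * C, ?_, ?_⟩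
  · calc (L * C).rank ≤ L.rank := Matrix.rank_mul_le_left _ _
      _ ≤ 4 * (2 * c₀) := hLr
      _ = 8 * c₀ := by ring
  · intro x y hx hy hI hJ
    have e : (L * C) x y = (L *ᵥ v y hy) x := by
      simp only [Matrix.mul_apply, Matrix.mulVec, dotProduct, C, Matrix.of_apply, dif_pos hy]
    rw [e]
    exact hv y hy x hx hI hJ

end Summit.PneNP.PneNP.Theorems.CnfIdealGenLengthRankDefectRepresentationsColumnSaturation
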